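import Summits.NavierStokesRegularity.FunctionalMining.NoGo.LogThresholdWitness
import HarnessLib

/-!
# The log-door threshold witness: profile bounds at scale `R` (`r = 1/R`, `K = R⁶`)

Search for candidate a priori estimates; no regularity claim. NS FUNCTIONAL MINING — NO-GO BRANCH
(cell `pub-nsfunc`, prove seat gen 4). With `r = 1/R`, `K = R⁶`, `a = a_r = bumpA(R·)`,
`g = g_K`, `η = etaZ`, and sup bounds `Āᵢ ≥ |bumpA⁽ⁱ⁾|`, `Eₖ ≥ |η⁽ᵏ⁾|`:
* `abs_iteratedDeriv_bumpR_le_R`: `|a⁽ⁱ⁾| ≤ Āᵢ Rⁱ`;  `Sq_bumpR_le`: `Sq a l ≤ 4 Āₗ² R^{2l}`;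
* `abs_iteratedDeriv_gK_le_Gamma`: `|g⁽ʲ⁾| ≤ Γ = K² + 4K𝒜 + 11𝒜` (`j ≤ 4`, `𝒜 = (1+ΣĀ)R⁴`);
* `abs_sep_prof_le`: `|sep (prof r K) i j k| ≤ 𝒜 Γ ℰ` (`i, j ≤ 4`, `k ≤ 3`);
* `Sq_gK_le_R`: `Sq g m ≤ 4(2 + 2Ā₁ + Ā₂)² R^{2m}` (`m ≤ 2`);
* `Sq_gK_three_ge_R`: `Sq g 3 ≥ R¹¹/4` once `R ≥ 2 + 16(Ā₃ + 3Ā₁ + 3Ā₂)²`;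
* real bookkeeping for the package (`mul_le_scale`, `vorticity_threshold_scale`,
  `junk_production_le`, `junk_palinstrophy_le`), `∫η³ > 0`, `∫η² > 0`, `scale_facts`.
Folklore calculus; nothing is asserted about Navier–Stokes.
-/

noncomputable section

open MeasureTheory Set Function Filter Real
open scoped ContDiff Topology Laplacian InnerProductSpace RealInnerProductSpace

namespace Summit.NavierStokesRegularity.FunctionalMining

namespace Sep3

open Literature.Analysis.FunctionSpaces Literature.Analysis.FluidPDE LogDoor

/-! ## Profile bounds at scale `R` -/

section Profiles

variable {R : ℝ} {A₁' A₂' A₃' A₄' : ℝ}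

/-- `|a_r⁽ⁱ⁾| ≤ Āᵢ Rⁱ` at `r = 1/R`. [folklore] -/
theorem abs_iteratedDeriv_bumpR_le_R (hR : 0 < R) {i : ℕ} {A : ℝ} (hA : ∀ t, |iteratedDeriv i bumpA t| ≤ A)
    (t : ℝ) : |iteratedDeriv i (bumpR (1 / R)) t| ≤ A * R ^ i := by
  have h := abs_iteratedDeriv_bumpR_le (r := 1 / R) (by positivity) hA t
  have e : A / (1 / R) ^ i = A * R ^ i := by rw [one_div, inv_pow, div_eq_mul_inv, inv_inv]
  rwa [e] at h

/-- Sup bounds of the packet profile `g_K = K⁻² a_r cos(K·)` and its first four derivatives at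
`K = R⁶`, `r = 1/R`: all `≤ Γ := K² + 4K𝒜 + 11𝒜` with `𝒜 = (1 + Ā₁ + Ā₂ + Ā₃ + Ā₄) R⁴`.
[folklore] -/
theorem abs_iteratedDeriv_gK_le_Gamma (hR : 1 ≤ R) (hA1 : ∀ t, |iteratedDeriv 1 bumpA t| ≤ A₁')
    (hA2 : ∀ t, |iteratedDeriv 2 bumpA t| ≤ A₂') (hA3 : ∀ t, |iteratedDeriv 3 bumpA t| ≤ A₃')
    (hA4 : ∀ t, |iteratedDeriv 4 bumpA t| ≤ A₄') {j : ℕ} (hj : j ≤ 4) (t : ℝ) :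
    |iteratedDeriv j (gK (bumpR (1 / R)) (R ^ 6)) t| ≤
      (R ^ 6) ^ 2 + 4 * R ^ 6 * ((1 + A₁' + A₂' + A₃' + A₄') * R ^ 4) +
        11 * ((1 + A₁' + A₂' + A₃' + A₄') * R ^ 4) := by
  have hR0 : 0 < R := by linarith
  have hr : 0 < 1 / R := by positivity
  have hK : 1 ≤ R ^ 6 := one_le_pow₀ hR
  have hR4 : 1 ≤ R ^ 4 := one_le_pow₀ hR
  have ha := bumpR_contDiff (1 / R)
  have hA₁ : 0 ≤ A₁' := (abs_nonneg _).trans (hA1 0)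
  have hA₂ : 0 ≤ A₂' := (abs_nonneg _).trans (hA2 0)
  have hA₃ : 0 ≤ A₃' := (abs_nonneg _).trans (hA3 0)
  have hA₄ : 0 ≤ A₄' := (abs_nonneg _).trans (hA4 0)
  set 𝒜 : ℝ := (1 + A₁' + A₂' + A₃' + A₄') * R ^ 4 with h𝒜
  have h𝒜1 : 1 ≤ 𝒜 := by rw [h𝒜]; nlinarith
  -- profile bounds `|a^{(i)}| ≤ Āᵢ Rⁱ ≤ 𝒜`
  have hpow : ∀ i : ℕ, i ≤ 4 → R ^ i ≤ R ^ 4 := fun i hi => pow_le_pow_right₀ hR hi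
  have b0 : ∀ t, |iteratedDeriv 0 (bumpR (1 / R)) t| ≤ 1 := fun t => by
    rw [iteratedDeriv_zero]; exact abs_bumpR_le _ t
  have bi : ∀ (i : ℕ) (Ai : ℝ), 0 ≤ Ai → Ai ≤ A₁' + A₂' + A₃' + A₄' → i ≤ 4 →
      (∀ t, |iteratedDeriv i bumpA t| ≤ Ai) → ∀ t, |iteratedDeriv i (bumpR (1 / R)) t| ≤ 𝒜 := by
    intro i Ai hAi hAle hi h t
    refine (abs_iteratedDeriv_bumpR_le_R hR0 h t).trans ?_
    rw [h𝒜]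
    calc Ai * R ^ i ≤ (A₁' + A₂' + A₃' + A₄') * R ^ 4 :=
          mul_le_mul hAle (hpow i hi) (by positivity) (by positivity)
      _ ≤ (1 + A₁' + A₂' + A₃' + A₄') * R ^ 4 := by nlinarith
  have b1 := bi 1 A₁' hA₁ (by linarith) (by norm_num) hA1
  have b2 := bi 2 A₂' hA₂ (by linarith) (by norm_num) hA2
  have b3 := bi 3 A₃' hA₃ (by linarith) (by norm_num) hA3
  have b4 := bi 4 A₄' hA₄ (by linarith) (by norm_num) hA4
  have hK0 : 0 ≤ R ^ 6 := by positivity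
  have hKK : R ^ 6 ≤ (R ^ 6) ^ 2 := by nlinarith
  interval_cases j
  · exact (abs_gK_le hK b0 t).trans (by nlinarith)
  · exact (abs_iteratedDeriv_gK_one_le ha hK b0 b1 t).trans (by nlinarith)
  · exact (abs_iteratedDeriv_gK_two_le ha hK b0 b1 b2 t).trans (by nlinarith)
  · exact (abs_iteratedDeriv_gK_three_le ha hK b0 b1 b2 b3 t).trans (by nlinarith)
  · exact (abs_iteratedDeriv_gK_four_le ha hK b0 b1 b2 b3 b4 t).trans (by nlinarith)

/-- **Sup bound for the separable monomials of the packet profiles** at `r = 1/R`, `K = R⁶`: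
`|sep (prof r K) i j k| ≤ 𝒜 Γ ℰ` for `i, j ≤ 4`, `k ≤ 3`. [folklore] -/
theorem abs_sep_prof_le (hR : 1 ≤ R) (hA1 : ∀ t, |iteratedDeriv 1 bumpA t| ≤ A₁')
    (hA2 : ∀ t, |iteratedDeriv 2 bumpA t| ≤ A₂') (hA3 : ∀ t, |iteratedDeriv 3 bumpA t| ≤ A₃')
    (hA4 : ∀ t, |iteratedDeriv 4 bumpA t| ≤ A₄') {E₁ E₂ E₃ : ℝ}
    (hE1 : ∀ t, |iteratedDeriv 1 etaZ t| ≤ E₁) (hE2 : ∀ t, |iteratedDeriv 2 etaZ t| ≤ E₂)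
    (hE3 : ∀ t, |iteratedDeriv 3 etaZ t| ≤ E₃)
    (i j k : ℕ) (y : E3) (hi : i ≤ 4) (hj : j ≤ 4) (hk : k ≤ 3) :
    |sep (prof (1 / R) (R ^ 6)) i j k y| ≤
      ((1 + A₁' + A₂' + A₃' + A₄') * R ^ 4) *
        ((R ^ 6) ^ 2 + 4 * R ^ 6 * ((1 + A₁' + A₂' + A₃' + A₄') * R ^ 4) +
          11 * ((1 + A₁' + A₂' + A₃' + A₄') * R ^ 4)) * (1 + E₁ + E₂ + E₃) := by
  have hR0 : 0 < R := by linarith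
  have hr : 0 < 1 / R := by positivity
  have hR4 : 1 ≤ R ^ 4 := one_le_pow₀ hR
  have hA₁ : 0 ≤ A₁' := (abs_nonneg _).trans (hA1 0)
  have hA₂ : 0 ≤ A₂' := (abs_nonneg _).trans (hA2 0)
  have hA₃ : 0 ≤ A₃' := (abs_nonneg _).trans (hA3 0)
  have hA₄ : 0 ≤ A₄' := (abs_nonneg _).trans (hA4 0)
  have hE₁ : 0 ≤ E₁ := (abs_nonneg _).trans (hE1 0)
  have hE₂ : 0 ≤ E₂ := (abs_nonneg _).trans (hE2 0)
  have hE₃ : 0 ≤ E₃ := (abs_nonneg _).trans (hE3 0)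
  set 𝒜 : ℝ := (1 + A₁' + A₂' + A₃' + A₄') * R ^ 4 with h𝒜
  set Γ : ℝ := (R ^ 6) ^ 2 + 4 * R ^ 6 * 𝒜 + 11 * 𝒜 with hΓ
  set ℰ : ℝ := 1 + E₁ + E₂ + E₃ with hℰ
  have h𝒜0 : 0 ≤ 𝒜 := by positivity
  have hΓ0 : 0 ≤ Γ := by positivity
  -- the three factors
  have fa : |iteratedDeriv i (bumpR (1 / R)) (y 0)| ≤ 𝒜 := by
    have hpow : R ^ i ≤ R ^ 4 := pow_le_pow_right₀ hR hi
    interval_cases i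
    · rw [iteratedDeriv_zero]; exact (abs_bumpR_le _ _).trans (by rw [h𝒜]; nlinarith)
    · exact (abs_iteratedDeriv_bumpR_le_R hR0 hA1 _).trans (by rw [h𝒜]; nlinarith)
    · exact (abs_iteratedDeriv_bumpR_le_R hR0 hA2 _).trans (by rw [h𝒜]; nlinarith)
    · exact (abs_iteratedDeriv_bumpR_le_R hR0 hA3 _).trans (by rw [h𝒜]; nlinarith)
    · exact (abs_iteratedDeriv_bumpR_le_R hR0 hA4 _).trans (by rw [h𝒜]; nlinarith)
  have fg : |iteratedDeriv j (gK (bumpR (1 / R)) (R ^ 6)) (y 1)| ≤ Γ :=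
    abs_iteratedDeriv_gK_le_Gamma hR hA1 hA2 hA3 hA4 hj _
  have fe : |iteratedDeriv k etaZ (y 2)| ≤ ℰ := by
    interval_cases k
    · rw [iteratedDeriv_zero]; exact (etaZ_facts _).1.trans (by rw [hℰ]; linarith)
    · exact (hE1 _).trans (by rw [hℰ]; linarith)
    · exact (hE2 _).trans (by rw [hℰ]; linarith)
    · exact (hE3 _).trans (by rw [hℰ]; linarith)
  rw [sep, prof_zero, prof_one, prof_two, abs_mul, abs_mul]
  exact mul_le_mul (mul_le_mul fa fg (abs_nonneg _) h𝒜0) fe (abs_nonneg _) (by positivity)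

/-- `Sq a_r l ≤ 4 Āₗ² R^{2l}` (`r = 1/R ≤ 1`). [folklore] -/
theorem Sq_bumpR_le (hR : 1 ≤ R) {l : ℕ} {A : ℝ} (hA : ∀ t, |iteratedDeriv l bumpA t| ≤ A) :
    Sq (bumpR (1 / R)) l ≤ 4 * (A * R ^ l) ^ 2 := by
  have hR0 : 0 < R := by linarith
  have hr : 0 < 1 / R := by positivity
  have hr1 : 1 / R ≤ 1 := by rw [div_le_one hR0]; exact hR
  exact Sq_le_of_abs_le (bumpR_contDiff _) (fun t ht => bumpR_eq_zero hr (by linarith)) l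
    fun t => abs_iteratedDeriv_bumpR_le_R hR0 hA t

/-- `Sq g_K m ≤ 4 (2 + 2Ā₁ + Ā₂)² R^{2m}` for `m ≤ 2` (`r = 1/R`, `K = R⁶`). [folklore] -/
theorem Sq_gK_le_R (hR : 1 ≤ R) (hA1 : ∀ t, |iteratedDeriv 1 bumpA t| ≤ A₁')
    (hA2 : ∀ t, |iteratedDeriv 2 bumpA t| ≤ A₂') {m : ℕ} (hm : m ≤ 2) :
    Sq (gK (bumpR (1 / R)) (R ^ 6)) m ≤ 4 * (2 + 2 * A₁' + A₂') ^ 2 * R ^ (2 * m) := by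
  have hR0 : 0 < R := by linarith
  have hr : 0 < 1 / R := by positivity
  have hr1 : 1 / R ≤ 1 := by rw [div_le_one hR0]; exact hR
  have hK : 1 ≤ R ^ 6 := one_le_pow₀ hR
  have ha := bumpR_contDiff (1 / R)
  have ha0 : ∀ t, 2 < |t| → bumpR (1 / R) t = 0 := fun t ht => bumpR_eq_zero hr (by linarith)
  have hA₁ : 0 ≤ A₁' := (abs_nonneg _).trans (hA1 0)
  have hA₂ : 0 ≤ A₂' := (abs_nonneg _).trans (hA2 0)
  have b0 : ∀ t, |iteratedDeriv 0 (bumpR (1 / R)) t| ≤ 1 := fun t => by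
    rw [iteratedDeriv_zero]; exact abs_bumpR_le _ t
  have b1 : ∀ t, |iteratedDeriv 1 (bumpR (1 / R)) t| ≤ A₁' * R := fun t => by
    simpa using abs_iteratedDeriv_bumpR_le_R hR0 hA1 t
  have b2 : ∀ t, |iteratedDeriv 2 (bumpR (1 / R)) t| ≤ A₂' * R ^ 2 := fun t =>
    abs_iteratedDeriv_bumpR_le_R hR0 hA2 t
  interval_cases m
  · refine (Sq_gK_le ha ha0 _ 0 fun t => abs_gK_le hK b0 t).trans ?_
    simp only [mul_zero, pow_zero, mul_one]
    nlinarith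
  · refine (Sq_gK_le ha ha0 _ 1 fun t => abs_iteratedDeriv_gK_one_le ha hK b0 b1 t).trans ?_
    have : (A₁' * R + 1) ^ 2 ≤ (2 + 2 * A₁' + A₂') ^ 2 * R ^ (2 * 1) := by
      have h1 : A₁' * R + 1 ≤ (2 + 2 * A₁' + A₂') * R := by nlinarith
      calc (A₁' * R + 1) ^ 2 ≤ ((2 + 2 * A₁' + A₂') * R) ^ 2 := pow_le_pow_left₀ (by positivity) h1 2
        _ = (2 + 2 * A₁' + A₂') ^ 2 * R ^ (2 * 1) := by ring
    linarith
  · refine (Sq_gK_le ha ha0 _ 2 fun t => abs_iteratedDeriv_gK_two_le ha hK b0 b1 b2 t).trans ?_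
    have : (A₂' * R ^ 2 + 1 + 2 * (A₁' * R)) ^ 2 ≤ (2 + 2 * A₁' + A₂') ^ 2 * R ^ (2 * 2) := by
      have hR2 : R ≤ R ^ 2 := by nlinarith
      have h1 : A₂' * R ^ 2 + 1 + 2 * (A₁' * R) ≤ (2 + 2 * A₁' + A₂') * R ^ 2 := by nlinarith
      calc (A₂' * R ^ 2 + 1 + 2 * (A₁' * R)) ^ 2 ≤ ((2 + 2 * A₁' + A₂') * R ^ 2) ^ 2 :=
            pow_le_pow_left₀ (by positivity) h1 2
        _ = (2 + 2 * A₁' + A₂') ^ 2 * R ^ (2 * 2) := by ring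
    linarith

/-- **The oscillation lower bound at scale `R`:** `Sq g_K 3 ≥ R¹¹/4` once `R ≥ 2 + 16c₃²`,
`c₃ = Ā₃ + 3Ā₁ + 3Ā₂` (`r = 1/R`, `K = R⁶`). [folklore] -/
theorem Sq_gK_three_ge_R (hR : 1 ≤ R) (hA1 : ∀ t, |iteratedDeriv 1 bumpA t| ≤ A₁')
    (hA2 : ∀ t, |iteratedDeriv 2 bumpA t| ≤ A₂') (hA3 : ∀ t, |iteratedDeriv 3 bumpA t| ≤ A₃')
    (hbig : 2 + 16 * (A₃' + 3 * A₁' + 3 * A₂') ^ 2 ≤ R) :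
    R ^ 11 / 4 ≤ Sq (gK (bumpR (1 / R)) (R ^ 6)) 3 := by
  have hR0 : 0 < R := by linarith
  have hr : 0 < 1 / R := by positivity
  have hr1 : 1 / R ≤ 1 := by rw [div_le_one hR0]; exact hR
  have hK : 1 ≤ R ^ 6 := one_le_pow₀ hR
  have ha := bumpR_contDiff (1 / R)
  have ha0 : ∀ t, 2 < |t| → bumpR (1 / R) t = 0 := fun t ht => bumpR_eq_zero hr (by linarith)
  have ha1 : ∀ t, |t| ≤ 1 / R → bumpR (1 / R) t = 1 := fun t ht => bumpR_eq_one hr ht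
  have hA₁ : 0 ≤ A₁' := (abs_nonneg _).trans (hA1 0)
  have hA₂ : 0 ≤ A₂' := (abs_nonneg _).trans (hA2 0)
  have hA₃ : 0 ≤ A₃' := (abs_nonneg _).trans (hA3 0)
  have b1 : ∀ t, |iteratedDeriv 1 (bumpR (1 / R)) t| ≤ A₁' * R := fun t => by
    simpa using abs_iteratedDeriv_bumpR_le_R hR0 hA1 t
  have b2 : ∀ t, |iteratedDeriv 2 (bumpR (1 / R)) t| ≤ A₂' * R ^ 2 := fun t =>
    abs_iteratedDeriv_bumpR_le_R hR0 hA2 t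
  have b3 : ∀ t, |iteratedDeriv 3 (bumpR (1 / R)) t| ≤ A₃' * R ^ 3 := fun t =>
    abs_iteratedDeriv_bumpR_le_R hR0 hA3 t
  have hC₃ := fun t => abs_iteratedDeriv_gK_three_sub_le ha hK b1 b2 b3 t
  have hg3 := Sq_gK_three_ge ha ha0 hr.le ha1 hK hC₃
  -- `C₃ ≤ c₃ R³`
  set c₃ : ℝ := A₃' + 3 * A₁' + 3 * A₂' with hc₃
  have hR2 : R ≤ R ^ 2 := by nlinarith
  have hR3 : R ^ 2 ≤ R ^ 3 := by nlinarith
  have hC3le : A₃' * R ^ 3 + 3 * (A₁' * R) + 3 * (A₂' * R ^ 2) ≤ c₃ * R ^ 3 := by rw [hc₃]; nlinarith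
  have hC3sq : (A₃' * R ^ 3 + 3 * (A₁' * R) + 3 * (A₂' * R ^ 2)) ^ 2 ≤ c₃ ^ 2 * R ^ 6 := by
    calc (A₃' * R ^ 3 + 3 * (A₁' * R) + 3 * (A₂' * R ^ 2)) ^ 2 ≤ (c₃ * R ^ 3) ^ 2 :=
          pow_le_pow_left₀ (by positivity) hC3le 2
      _ = c₃ ^ 2 * R ^ 6 := by ring
  -- `K² r / 2 = R¹¹ / 2`, `K/2 + 4C₃² ≤ (1/2 + 4c₃²) R⁶ ≤ R¹¹/4`
  have e1 : (R ^ 6) ^ 2 * (1 / R) / 2 = R ^ 11 / 2 := by field_simp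
  have hR5 : R ≤ R ^ 5 := by
    calc R = R ^ 1 := (pow_one R).symm
      _ ≤ R ^ 5 := pow_le_pow_right₀ hR (by norm_num)
  have hbig' : (2 + 16 * c₃ ^ 2) * R ^ 6 ≤ R ^ 11 := by
    have : (2 + 16 * c₃ ^ 2) ≤ R ^ 5 := hbig.trans hR5
    calc (2 + 16 * c₃ ^ 2) * R ^ 6 ≤ R ^ 5 * R ^ 6 := mul_le_mul_of_nonneg_right this (by positivity)
      _ = R ^ 11 := by ring
  rw [e1] at hg3
  have hR6 : 0 ≤ R ^ 6 := by positivity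
  nlinarith [hg3, hC3sq, hbig', mul_nonneg hR6 (sq_nonneg c₃)]

end Profiles

/-! ## Real bookkeeping and scale facts for the package -/

/-- Products of scale-bounded quantities: `a ≤ 𝔞Rⁱ`, `g ≤ 𝔤Rʲ`, `i + j ≤ 6`, `R ≥ 1` give
`a g ≤ 𝔞 𝔤 R⁶` (for `a, g, 𝔞, 𝔤 ≥ 0`). [folklore] -/
theorem mul_le_scale {a g 𝔞 𝔤 R : ℝ} {i j : ℕ} (hR : 1 ≤ R) (ha0 : 0 ≤ a) (hg0 : 0 ≤ g)
    (h𝔞 : 0 ≤ 𝔞) (h𝔤 : 0 ≤ 𝔤) (ha : a ≤ 𝔞 * R ^ i) (hg : g ≤ 𝔤 * R ^ j) (hij : i + j ≤ 6) :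
    a * g ≤ 𝔞 * 𝔤 * R ^ 6 := by
  calc a * g ≤ (𝔞 * R ^ i) * (𝔤 * R ^ j) := mul_le_mul ha hg hg0 (ha0.trans ha)
    _ = 𝔞 * 𝔤 * R ^ (i + j) := by rw [pow_add]; ring
    _ ≤ 𝔞 * 𝔤 * R ^ 6 := mul_le_mul_of_nonneg_left (pow_le_pow_right₀ hR hij) (mul_nonneg h𝔞 h𝔤)

/-- `∫η³ > 0`. [folklore] -/
theorem J_etaZ_pos : 0 < J etaZ (0, 0, 0) := by
  refine J_pos etaZ_contDiff etaZ_zero _ (fun t => ?_) (t₀ := 0) ?_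
  · simp only [tri, iteratedDeriv_zero]
    have := (etaZ_facts t).2.1
    positivity
  · simp [tri, iteratedDeriv_zero, (etaZ_facts 0).2.2]

/-- `∫η² > 0`. [folklore] -/
theorem Sq_etaZ_zero_pos : 0 < Sq etaZ 0 := by
  rw [Sq]
  refine (etaZ_contDiff.continuous_iteratedDeriv 0 (by exact_mod_cast le_top)).pow 2
    |>.integral_pos_of_hasCompactSupport_nonneg_nonzero ?_ (fun t => sq_nonneg _) (x := 0) ?_
  · exact HasCompactSupport.intro (isCompact_Icc (a := (-2 : ℝ)) (b := 2)) fun t ht => by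
      simp [iteratedDeriv_eq_zero_of_abs_lt etaZ_zero 0 t (two_lt_abs_of_not_mem_Icc ht)]
  · simp [iteratedDeriv_zero, (etaZ_facts 0).2.2]

/-- Powers of `2ⁿ` against `R = 4·2ⁿ`: `64ⁿ ≤ R⁶`, `256ⁿ ≤ R⁸`, `256ⁿ ≤ 2^{32n}`,
`R³² = 4³² 2^{32n}`, `n ≤ R`, `4 ≤ R`. [folklore] -/
theorem scale_facts (n : ℕ) :
    (64 : ℝ) ^ n ≤ (4 * 2 ^ n) ^ 6 ∧ (256 : ℝ) ^ n ≤ (4 * 2 ^ n) ^ 8 ∧ (256 : ℝ) ^ n ≤ 2 ^ (32 * n) ∧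
      ((4 : ℝ) * 2 ^ n) ^ 32 = 4 ^ 32 * 2 ^ (32 * n) ∧ (n : ℝ) ≤ 4 * 2 ^ n ∧ (4 : ℝ) ≤ 4 * 2 ^ n := by
  have h2n : (1 : ℝ) ≤ 2 ^ n := one_le_pow₀ (by norm_num)
  refine ⟨?_, ?_, ?_, ?_, ?_, by linarith⟩
  · calc (64 : ℝ) ^ n = (2 ^ n) ^ 6 := by rw [← pow_mul, mul_comm, pow_mul]; norm_num
      _ ≤ (4 * 2 ^ n) ^ 6 := pow_le_pow_left₀ (by positivity) (by linarith) 6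
  · calc (256 : ℝ) ^ n = (2 ^ n) ^ 8 := by rw [← pow_mul, mul_comm, pow_mul]; norm_num
      _ ≤ (4 * 2 ^ n) ^ 8 := pow_le_pow_left₀ (by positivity) (by linarith) 8
  · calc (256 : ℝ) ^ n = 2 ^ (8 * n) := by rw [pow_mul]; norm_num
      _ ≤ 2 ^ (32 * n) := pow_le_pow_right₀ (by norm_num) (by omega)
  · rw [mul_pow, ← pow_mul, mul_comm n 32]
  · have : (n : ℝ) ≤ 2 ^ n := by exact_mod_cast Nat.lt_two_pow_self.le
    linarith

/-- The frequency threshold of `witness_vorticity` at scale `R`: `K = R⁶` dominates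
`1 + 2A₁R + 2A₂R² + (A₁R + 1)E₁ + A₁R E₁` once `R ≥ 1 + 2A₁ + 2A₂ + (A₁+1)E₁ + A₁E₁`. [folklore] -/
theorem vorticity_threshold_scale {R A₁ A₂ E₁ : ℝ} (hR : 1 ≤ R) (hA₁ : 0 ≤ A₁) (hA₂ : 0 ≤ A₂)
    (hE₁ : 0 ≤ E₁) (hc : 1 + 2 * A₁ + 2 * A₂ + (A₁ + 1) * E₁ + A₁ * E₁ ≤ R) :
    1 + 2 * (A₁ * R) + 2 * (A₂ * R ^ 2) + (A₁ * R + 1) * E₁ + A₁ * R * E₁ ≤ R ^ 6 := by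
  have hR2 : R ≤ R ^ 2 := by nlinarith
  have hR1' : (1 : ℝ) ≤ R ^ 2 := one_le_pow₀ hR
  have h1 : 1 + 2 * (A₁ * R) + 2 * (A₂ * R ^ 2) + (A₁ * R + 1) * E₁ + A₁ * R * E₁ ≤
      (1 + 2 * A₁ + 2 * A₂ + (A₁ + 1) * E₁ + A₁ * E₁) * R ^ 2 := by
    nlinarith [mul_nonneg hA₁ hE₁, mul_nonneg (mul_nonneg hA₁ hE₁) (sub_nonneg.2 hR2),
      mul_nonneg hE₁ (sub_nonneg.2 hR2), mul_nonneg hA₂ (sub_nonneg.2 hR1'), mul_nonneg hA₁ (sub_nonneg.2 hR2),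
      sub_nonneg.2 hR2]
  calc _ ≤ (1 + 2 * A₁ + 2 * A₂ + (A₁ + 1) * E₁ + A₁ * E₁) * R ^ 2 := h1
    _ ≤ R * R ^ 2 := mul_le_mul_of_nonneg_right hc (by positivity)
    _ = R ^ 3 := by ring
    _ ≤ R ^ 6 := pow_le_pow_right₀ hR (by norm_num)

/-- Real bookkeeping for the production junk: the background self-production and the two
wrong-sign packet terms are absorbed by half of the main term. [folklore] -/
theorem junk_production_le {κN P Jc α₀ 𝔞 𝔤 R n s X : ℝ} (hn : 1 ≤ n) (hJ : 0 < Jc)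
    (hα : 0 < α₀) (hκ : 0 ≤ κN) (hP : P ≤ R ^ 8) (h1 : 16 * κN ≤ Jc * α₀ * R ^ 2)
    (h2 : 32 * 𝔞 * 𝔤 ≤ α₀ * R ^ 4) (hs : s ≤ 2 * (𝔞 * 𝔤 * R ^ 6)) (hX : α₀ * R ^ 10 / 4 ≤ X) :
    κN * P + n * Jc * s ≤ n * Jc * X / 2 := by
  have hnJ : 0 ≤ n * Jc := by nlinarith
  have h8 : 0 ≤ R ^ 8 := by positivity
  have h6 : 0 ≤ R ^ 6 := by positivity
  have i1 : κN * P ≤ n * Jc * (α₀ * R ^ 10 / 4) / 4 := by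
    have e : n * Jc * (α₀ * R ^ 10 / 4) / 4 = n * (Jc * α₀ * R ^ 2) * R ^ 8 / 16 := by ring
    rw [e]
    have s1 : κN * P ≤ κN * R ^ 8 := mul_le_mul_of_nonneg_left hP hκ
    have s2 : κN * R ^ 8 * 16 ≤ 1 * (Jc * α₀ * R ^ 2) * R ^ 8 := by nlinarith
    have s3 : 1 * (Jc * α₀ * R ^ 2) * R ^ 8 ≤ n * (Jc * α₀ * R ^ 2) * R ^ 8 :=
      mul_le_mul_of_nonneg_right (mul_le_mul_of_nonneg_right hn (by positivity)) h8
    linarith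
  have i2 : n * Jc * s ≤ n * Jc * (α₀ * R ^ 10 / 4) / 4 := by
    have : 2 * (𝔞 * 𝔤 * R ^ 6) ≤ α₀ * R ^ 10 / 16 := by
      have e : α₀ * R ^ 10 / 16 = (α₀ * R ^ 4) * R ^ 6 / 16 := by ring
      rw [e]; nlinarith
    calc n * Jc * s ≤ n * Jc * (α₀ * R ^ 10 / 16) := mul_le_mul_of_nonneg_left (hs.trans this) hnJ
      _ = n * Jc * (α₀ * R ^ 10 / 4) / 4 := by ring
  have : n * Jc * (α₀ * R ^ 10 / 4) ≤ n * Jc * X := mul_le_mul_of_nonneg_left hX hnJ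
  linarith

/-- Real bookkeeping for the palinstrophy junk: the background palinstrophy and the subleading
packet terms are at most the main term. [folklore] -/
theorem junk_palinstrophy_le {κP P e0 α₀ c R s X : ℝ} (he : 0 < e0)
    (hκ : 0 ≤ κP) (hP : P ≤ R ^ 6) (h3 : 4 * (κP + c) ≤ e0 * α₀ * R ^ 4) (hs : s ≤ c * R ^ 6)
    (hX : α₀ * R ^ 10 / 4 ≤ X) : κP * P + s ≤ e0 * X := by
  have h6 : 0 ≤ R ^ 6 := by positivity
  have hXe : e0 * (α₀ * R ^ 10 / 4) ≤ e0 * X := mul_le_mul_of_nonneg_left hX he.le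
  have hkey : (κP + c) * R ^ 6 ≤ e0 * (α₀ * R ^ 10 / 4) := by
    have e : e0 * (α₀ * R ^ 10 / 4) = (e0 * α₀ * R ^ 4) * R ^ 6 / 4 := by ring
    rw [e]; nlinarith
  have s1 : κP * P ≤ κP * R ^ 6 := mul_le_mul_of_nonneg_left hP hκ
  nlinarith


end Sep3

end Summit.NavierStokesRegularity.FunctionalMining

end
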